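import Summits.QuantumFields.YangMills.Theorems.UnitScaleTiltProp7CornerCombStraightStepMean
import Summits.QuantumFields.YangMills.Theorems.UnitScaleTiltProp7CornerCombInCellPoincare
import Summits.QuantumFields.YangMills.Theorems.UnitScaleTiltProp7CornerCombLoopDefects
import Literature.MathematicalPhysics.QuantumFieldTheory.Balaban1983to89.B9Eq319QprimeLipschitzTwoBackgrounds
import Summits.QuantumFields.YangMills.Theorems.UnitScaleTiltProp7CornerCombTwoLevelTransport
import HarnessLib

/-!
# Route `UnitScaleTilt`, crux K1 «MinimiserStabilityRegPr» (stmt-QuantumFields-19200), route-R E′ (A′)-on-Σ, P-A2 (β), row «(n3)-comb» —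
# (O2) GROUNDWORK, file F-6c-2b: THE DRESSED ONE-SCALE ROW
# («the normalised TRANSPORTED block mean of one covariant straight step, one level up, against the transported block mean at the common corner:
# a covariant Poincaré term on a cube of side `L² + L`, plus RELATIVE transport defects `O(δ + a)`, plus the defect field»)

«(O2) groundwork — not consumed by any displayed row before the freeze lifts» (★★OWNER `ym3-torus-plan` g29∕g30 RULINGS №20 (2), №22; «(II) GO» 06:26∕06:31Z;
PENS ROUND 3 08:01:48Z, organisation «β»; F-6c-3 = w3-19200 g13 (✓F-6c-3a abstract chain), this file = the one-scale input it asks for).  Cell `ym3-torus`,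
D-0154 (3c) R3 twin-width seat `ym-routeR-w1` (gen 9).  THEOREMS ONLY (0 `def`, 0 `sorry`); `--supports stmt-QuantumFields-19200 --as helper`, count-neutral.
YM₃ on T³ is a ladder rung (R3), not the Clay problem; nothing here claims `hMcomb`, `hMcomb₂`, (β), `hPA2`, `hcoS`, the stub, the crux, d = 4 or the mass gap.

THE POINT (MASTER `DESIGN-N3COMB-LINEAR-CORE-routeRw1g9.md` §1 rows 6–7, organisation β).  Level `i` background `V` (U1, plaquettes `≤ a`), next background `V′` (U1,
ABSTRACT: every bond `δ`-close to the straight `L`-segment holonomy of `V` — discharged at `V′ = avgIter (i+1)` with `δ = 4α` by ✓F-6c-2a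
`Prop7CornerCombTwoLevelTransport.norm_rescale_bavg_sub_hol_seg_le`), level-`i` field `X`, next field `X′ = L•Q0cov L V X (L•·) + D` written in ★routeR-w4's unfolded
form (✓`Prop7CornerCombCovGradTransfer.smul_Q0cov_eq_sum`: `Lᵈ·L` transported bond values) with a FREE defect field `D` (the knit feeds `D := DEF_i(G_i)` of ✓F-5a).  The
TRANSPORTED block means are ✓F-6a-2's letter token for token: `X̄ᵀ_μ(q) := L⁻ᵈ • Σ_s conjR (hol V q (treeWord s)) (X (q + s) μ)` at level `i` (corner `q = L•q″`) and
`X̄′ᵀ_μ(q″) := L⁻ᵈ • Σ_{s′} conjR (hol V′ q″ (treeWord s′)) (X′ (q″ + s′) μ)` at level `i+1`.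
★★★ `normSq_invL_meanT_step_sub_meanT_le`: for any cube `Q = q + [0,n+1)ᵈ` with `L² + L ≤ n + 1`,
  `‖L⁻¹ • X̄′ᵀ_μ(q″) − X̄ᵀ_μ(q)‖² ≤ L⁻ᵈ·( 3N(n+1)²·GRAD^{cov}_Q(X) + (12N(n+1)²d³n²a² + 3κ₀²)·MASS_Q(X) ) + 3·L⁻²·L⁻ᵈ·Σ_{s′} ‖D (q″ + s′) μ‖²`, `κ₀ = 2dLδ + 2((3d+1)n)²a`,
`GRAD^{cov}_Q`∕`MASS_Q` = ✓F-6a-2 §2's letters on `Q` (all components).  Mechanism: (T1) ✓F-6c-2a `norm_hol_treeWord_sub_le` replaces the level-(i+1) tree transport by the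
level-`i` transport of the dilated corner vector (`2dLδ‖X‖` per bond value, lit ✓`norm_conj_sub_conj_le_of_mem_U1`); (T2) the composite transport «dilated tree ++ tree_r ++
seg_t» is ONE level-`i` word from `q` (✓`conjR_conjR`, ✓`hol_append`) — EXACT; (T3) re-basing it to `Q`'s own tree word costs a loop of length `≤ 2(3d+1)n` (✓cov-1
`Prop7CornerCombLoopDefects.norm_conjR_hol_sub_conjR_hol_le`); (T4) Jensen ×(L+1) against the cube mean of the tree-transported field (✓F-6c-1 `normSq_mean_comp_sub_le` with
the index injections `(s′, r) ↦ L s′ + r + tδ_μ`, `s ↦ s`) + ✓F-6a-2 §2 `sum_normSq_combTransported_sub_mean_le` on `Q`; (T5) Jensen for `D` (conjugation is an isometry).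
Constants closed polynomials in (d, L, n, N); nothing reads a level, `k`, the torus, `K`, the member ((g1)(g2)); every defect is RELATIVE (`δ, a` multiply `MASS`) — kill line respected.
HONEST SCOPE.  One-step bookkeeping over cited tree∕lit rows; the chain per corner is ✓F-6c-3a∕3b (w3-19200 g13), the sum over corners + transfer + Weitzenböck is F-6d.
Nothing of Bałaban's is asserted beyond the cited tree∕lit theorems.

References: T. Bałaban, CMP **98** (1985) 17–51 [Balaban1985Averaging] ((42)–(47) pp.23–25, (65) p.29, (125) p.36); CMP **89** (1983) 571–597 [Balaban1983RegularityDecay] ((2.27) p.580);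
CMP **96** (1984) 223–250 [Balaban1984PropagatorsII] ((1.9) p.226).
-/

set_option autoImplicit false

noncomputable section

open scoped BigOperators Matrix.Norms.L2Operator

namespace Summit.QuantumFields.YangMills.Theorems.Prop7CornerCombDressedStepMean

open Finset
open Literature.MathematicalPhysics.QuantumFieldTheory.Balaban1983to89
open B7Prop1Explicit (Site Letter e boxVec seg treeWord hol disp l1 U1 mem_U1 hol_mem plaqWord e_apply hol_append hol_nil hol_seg_natCast_succ
  seg_natCast disp_seg disp_treeWord disp_append length_treeWord length_seg l1_boxVec_le Wcx bavg)
open B7Eq78Linearization (conjR conjR_apply conjR_add conjR_sub conjR_smul_real)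
open B8Ineq132 (conjR_conjR conjR_sum norm_conjR norm_conjR_le)
open Summit.QuantumFields.YangMills.Theorems.Prop7CornerCombTwoLevelTransport (norm_hol_treeWord_sub_le dilateIdx_injective boxVec_dilateIdx
  length_treeWord_smul_boxVec_le)
open B9Eq319QprimeLipschitzTwoBackgrounds (norm_conj_sub_conj_le_of_mem_U1)
open Summit.QuantumFields.YangMills.Theorems.Prop7CornerCombLoopDefects (norm_conjR_hol_sub_conjR_hol_le)
open Summit.QuantumFields.YangMills.Theorems.Prop7CornerCombInCellPoincare (sum_normSq_combTransported_sub_mean_le)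
open Summit.QuantumFields.YangMills.Theorems.Prop7CornerCombInCellLetters (length_treeWord_boxVec_le)
open Summit.QuantumFields.YangMills.Theorems.Prop7CornerCombStraightStepMean (normSq_mean_comp_sub_le boxVec_castLE)

/-! ## The dressed one-scale row (`M_N(ℂ)`-valued fields, operator norm) -/

section Row

variable {d N : ℕ} [NeZero N]

/-- ★★★ **THE DRESSED ONE-SCALE ROW.**  Level-`i` background `V` (U1, plaquettes `≤ a`), next background `V′` (U1, bonds `δ`-close to the straight `L`-segments of `V`), fields
`X` (level i), `X′ = L•Q₀^{cov}(X) + D` at the level-(i+1) block `q″ + [0,L)ᵈ` (★routeR-w4's unfolded `smul_Q0cov_eq_sum` form, `D` free), `q = L•q″`, any cube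
`q + [0,n+1)ᵈ` with `L² + L ≤ n + 1`.  Then
`‖L⁻¹ • X̄′ᵀ_μ(q″) − X̄ᵀ_μ(q)‖² ≤ L⁻ᵈ·(3N(n+1)²·GRAD^{cov}_Q(X) + (12N(n+1)²d³n²a² + 3κ₀²)·MASS_Q(X)) + 3·L⁻²·L⁻ᵈ·Σ_{s′}‖D(q″+s′) μ‖²`, `κ₀ = 2dLδ + 2((3d+1)n)²a`
((T1)–(T5) of the module docstring). [cite: Balaban1985Averaging, (42)–(47) pp.23–25, (65) p.29, (125) p.36; Balaban1983RegularityDecay, (2.27) p.580] -/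
theorem normSq_invL_meanT_step_sub_meanT_le (L : ℕ) (hL : 1 ≤ L) (n : ℕ) (hn : L * L + L ≤ n + 1)
    (V : Site d → Fin d → (Matrix (Fin N) (Fin N) ℂ)ˣ) (hV : ∀ x κ, V x κ ∈ U1 (Matrix (Fin N) (Fin N) ℂ)) {a : ℝ} (ha : 0 ≤ a)
    (hplaq : ∀ (x : Site d) (κ μ : Fin d), κ ≠ μ →
      ‖((hol V x (plaqWord κ μ) : (Matrix (Fin N) (Fin N) ℂ)ˣ) : Matrix (Fin N) (Fin N) ℂ) - 1‖ ≤ a)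
    (V' : Site d → Fin d → (Matrix (Fin N) (Fin N) ℂ)ˣ) (hV' : ∀ x κ, V' x κ ∈ U1 (Matrix (Fin N) (Fin N) ℂ)) {δ : ℝ} (hδ : 0 ≤ δ)
    (hbs : ∀ (z : Site d) (ν : Fin d), ‖((V' z ν : (Matrix (Fin N) (Fin N) ℂ)ˣ) : Matrix (Fin N) (Fin N) ℂ)
      - ((hol V ((L : ℤ) • z) (seg ν (L : ℤ)) : (Matrix (Fin N) (Fin N) ℂ)ˣ) : Matrix (Fin N) (Fin N) ℂ)‖ ≤ δ)
    (X X' D : Site d → Fin d → Matrix (Fin N) (Fin N) ℂ) (μ : Fin d) (q'' : Site d)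
    (hX' : ∀ s' : Fin d → Fin L, X' (q'' + boxVec L s') μ
      = ∑ r : Fin d → Fin L, ∑ t ∈ Finset.range L, (((L : ℝ) ^ d)⁻¹) •
          conjR (hol V ((L : ℤ) • (q'' + boxVec L s')) (treeWord (boxVec L r) ++ seg μ (t : ℤ)))
            (X ((L : ℤ) • (q'' + boxVec L s') + boxVec L r + (t : ℤ) • e μ) μ)
        + D (q'' + boxVec L s') μ) :
    ‖(L : ℝ)⁻¹ • ((((L : ℝ) ^ d)⁻¹) • ∑ s' : Fin d → Fin L, conjR (hol V' q'' (treeWord (boxVec L s'))) (X' (q'' + boxVec L s') μ))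
        - (((L : ℝ) ^ d)⁻¹) • ∑ s : Fin d → Fin L, conjR (hol V ((L : ℤ) • q'') (treeWord (boxVec L s))) (X ((L : ℤ) • q'' + boxVec L s) μ)‖ ^ 2
      ≤ ((L : ℝ) ^ d)⁻¹ *
          (3 * N * ((n : ℝ) + 1) ^ 2 *
              ∑ μ' : Fin d, ∑ ν : Fin d, ∑ ρ ∈ univ.filter (fun ρ : Fin d → Fin (n + 1) => ρ ν ≠ Fin.last n),
                ‖conjR (V ((L : ℤ) • q'' + boxVec (n + 1) ρ) ν) (X ((L : ℤ) • q'' + boxVec (n + 1) ρ + e ν) μ')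
                  - X ((L : ℤ) • q'' + boxVec (n + 1) ρ) μ'‖ ^ 2
            + (12 * N * ((n : ℝ) + 1) ^ 2 * (d : ℝ) ^ 3 * (n : ℝ) ^ 2 * a ^ 2
                + 3 * (2 * d * L * δ + 2 * ((3 * d + 1) * n : ℝ) ^ 2 * a) ^ 2) *
              ∑ μ' : Fin d, ∑ ρ : Fin d → Fin (n + 1), ‖X ((L : ℤ) • q'' + boxVec (n + 1) ρ) μ'‖ ^ 2)
        + 3 * ((L : ℝ) ^ 2)⁻¹ * ((L : ℝ) ^ d)⁻¹ * ∑ s' : Fin d → Fin L, ‖D (q'' + boxVec L s') μ‖ ^ 2 := by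
  classical
  have hL0 : 0 < L := hL
  have hLr : (0 : ℝ) < L := by exact_mod_cast hL0
  have hLL : L * L ≤ n := by
    have : L * L + 1 ≤ L * L + L := by omega
    omega
  have hLn : L ≤ n + 1 := by nlinarith
  have hLn' : L ≤ n := le_trans (by nlinarith : L ≤ L * L) hLL
  haveI : Nonempty (Fin d → Fin L) := ⟨fun _ => ⟨0, hL0⟩⟩
  set q : Site d := (L : ℤ) • q'' with hq
  set F : (Fin d → Fin (n + 1)) → Matrix (Fin N) (Fin N) ℂ :=
    fun ρ => conjR (hol V q (treeWord (boxVec (n + 1) ρ))) (X (q + boxVec (n + 1) ρ) μ) with hF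
  set Fbar : Matrix (Fin N) (Fin N) ℂ := (((n : ℝ) + 1) ^ d)⁻¹ • ∑ ρ, F ρ with hFbar
  set P : ℝ := ∑ ρ, ‖F ρ - Fbar‖ ^ 2 with hP
  set GRAD : ℝ := ∑ μ' : Fin d, ∑ ν : Fin d, ∑ ρ ∈ univ.filter (fun ρ : Fin d → Fin (n + 1) => ρ ν ≠ Fin.last n),
      ‖conjR (V (q + boxVec (n + 1) ρ) ν) (X (q + boxVec (n + 1) ρ + e ν) μ') - X (q + boxVec (n + 1) ρ) μ'‖ ^ 2 with hGRAD
  set MASS : ℝ := ∑ μ' : Fin d, ∑ ρ : Fin d → Fin (n + 1), ‖X (q + boxVec (n + 1) ρ) μ'‖ ^ 2 with hMASS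
  set DD : ℝ := ∑ s' : Fin d → Fin L, ‖D (q'' + boxVec L s') μ‖ ^ 2 with hDD
  set κ₀ : ℝ := 2 * d * L * δ + 2 * ((3 * d + 1) * n : ℝ) ^ 2 * a with hκ₀
  have hP0 : 0 ≤ P := Finset.sum_nonneg fun _ _ => sq_nonneg _
  have hGRAD0 : 0 ≤ GRAD := Finset.sum_nonneg fun _ _ => Finset.sum_nonneg fun _ _ => Finset.sum_nonneg fun _ _ => sq_nonneg _
  have hMASS0 : 0 ≤ MASS := Finset.sum_nonneg fun _ _ => Finset.sum_nonneg fun _ _ => sq_nonneg _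
  have hDD0 : 0 ≤ DD := Finset.sum_nonneg fun _ _ => sq_nonneg _
  have hκ₀0 : 0 ≤ κ₀ := by rw [hκ₀]; positivity
  -- (T4a) the covariant cube Poincaré inequality with the mean (F-6a-2 §2), read at the component `μ`
  have hPle : P ≤ N / 8 * ((n : ℝ) + 1) ^ 2 * (2 * GRAD + 8 * (d : ℝ) ^ 3 * (n : ℝ) ^ 2 * a ^ 2 * MASS) := by
    have h := sum_normSq_combTransported_sub_mean_le n V hV ha hplaq X q
    refine le_trans ?_ h
    have hsingle := Finset.single_le_sum (s := (Finset.univ : Finset (Fin d)))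
      (f := fun μ' : Fin d => ∑ s : Fin d → Fin (n + 1), ‖conjR (hol V q (treeWord (boxVec (n + 1) s))) (X (q + boxVec (n + 1) s) μ')
        - (((n : ℝ) + 1) ^ d)⁻¹ • ∑ s' : Fin d → Fin (n + 1), conjR (hol V q (treeWord (boxVec (n + 1) s'))) (X (q + boxVec (n + 1) s') μ')‖ ^ 2)
      (fun _ _ => Finset.sum_nonneg fun _ _ => sq_nonneg _) (Finset.mem_univ μ)
    exact hsingle
  let ιB : (Fin d → Fin L) → (Fin d → Fin (n + 1)) := fun s i => Fin.castLE hLn (s i)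
  have hιB : Function.Injective ιB := by
    intro s s' hss'; funext i
    exact Fin.castLE_injective hLn (congrFun hss' i)
  let ιC : ℕ → (Fin d → Fin L) × (Fin d → Fin L) → (Fin d → Fin (n + 1)) := fun t p i =>
    (⟨L * (p.1 i : ℕ) + (p.2 i : ℕ) + (if i = μ then min t (L - 1) else 0), by
        have h1 : L * ((p.1 i : ℕ) + 1) ≤ L * L := Nat.mul_le_mul_left L (p.1 i).isLt
        have h2 := (p.2 i).isLt
        have h3 : min t (L - 1) ≤ L - 1 := min_le_right _ _
        rw [Nat.mul_succ] at h1
        split_ifs <;> omega⟩ : Fin (n + 1))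
  have hιC : ∀ t, Function.Injective (ιC t) := fun t => dilateIdx_injective L n hL0 hn μ t
  have hwB : ∀ s : Fin d → Fin L, boxVec (n + 1) (ιB s) = boxVec L s := fun s => boxVec_castLE hLn s
  have hwC : ∀ t, t < L → ∀ p : (Fin d → Fin L) × (Fin d → Fin L),
      boxVec (n + 1) (ιC t p) = (L : ℤ) • boxVec L p.1 + boxVec L p.2 + (t : ℤ) • e μ := fun t ht p => boxVec_dilateIdx L n hn μ ht p
  -- (T1)+(T2)+(T3): every transported bond value entering the next-level mean is `κ₀‖X‖`-close to the canonically transported value on the cube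
  have hterm : ∀ t, t < L → ∀ (s' r : Fin d → Fin L),
      ‖conjR (hol V' q'' (treeWord (boxVec L s')))
          (conjR (hol V (q + (L : ℤ) • boxVec L s') (treeWord (boxVec L r) ++ seg μ (t : ℤ)))
            (X (q + (L : ℤ) • boxVec L s' + boxVec L r + (t : ℤ) • e μ) μ))
        - F (ιC t (s', r))‖ ≤ κ₀ * ‖X (q + (L : ℤ) • boxVec L s' + boxVec L r + (t : ℤ) • e μ) μ‖ := by
    intro t ht s' r
    set w : Site d := q + (L : ℤ) • boxVec L s' + boxVec L r + (t : ℤ) • e μ with hw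
    set Pin : List (Letter d) := treeWord (boxVec L r) ++ seg μ (t : ℤ) with hPin
    set Pout : List (Letter d) := treeWord ((L : ℤ) • boxVec L s') with hPout
    set Yv : Matrix (Fin N) (Fin N) ℂ := conjR (hol V (q + (L : ℤ) • boxVec L s') Pin) (X w μ) with hYv
    have hY : ‖Yv‖ = ‖X w μ‖ := norm_conjR (hol_mem hV _ _) _
    -- (T1) the next-level tree transport against the dilated level-`i` tree transport
    have h1 : ‖conjR (hol V' q'' (treeWord (boxVec L s'))) Yv - conjR (hol V q Pout) Yv‖ ≤ 2 * (d * L * δ) * ‖X w μ‖ := by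
      have hc := norm_conj_sub_conj_le_of_mem_U1 (hol_mem hV' q'' (treeWord (boxVec L s'))) (hol_mem hV q Pout) Yv
      have hT := norm_hol_treeWord_sub_le L hV hV' hbs q'' s'
      rw [← hq] at hT
      have hlen : ((treeWord (boxVec L s')).length : ℝ) * δ ≤ d * L * δ := by
        refine mul_le_mul_of_nonneg_right ?_ hδ
        rw [length_treeWord]; exact_mod_cast l1_boxVec_le L s'
      rw [conjR_apply, conjR_apply]
      calc _ ≤ 2 * ‖((hol V' q'' (treeWord (boxVec L s')) : (Matrix (Fin N) (Fin N) ℂ)ˣ) : Matrix (Fin N) (Fin N) ℂ)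
              - ((hol V q Pout : (Matrix (Fin N) (Fin N) ℂ)ˣ) : Matrix (Fin N) (Fin N) ℂ)‖ * ‖Yv‖ := hc
        _ ≤ 2 * (d * L * δ) * ‖X w μ‖ := by
          rw [hY]
          exact mul_le_mul_of_nonneg_right (mul_le_mul_of_nonneg_left (hT.trans hlen) (by norm_num)) (norm_nonneg _)
    -- (T2) the composite transport is ONE level-`i` word from `q` (exact)
    have h2 : conjR (hol V q Pout) Yv = conjR (hol V q (Pout ++ Pin)) (X w μ) := by
      rw [hYv, conjR_conjR, hPout, hPin, hol_append V q (treeWord ((L : ℤ) • boxVec L s')), disp_treeWord]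
    -- (T3) re-basing to the cube's own tree word
    have hpt : q + boxVec (n + 1) (ιC t (s', r)) = w := by rw [hwC t ht (s', r), hw]; abel
    have hF' : F (ιC t (s', r)) = conjR (hol V q (treeWord (boxVec (n + 1) (ιC t (s', r))))) (X w μ) := by
      show conjR (hol V q (treeWord (boxVec (n + 1) (ιC t (s', r))))) (X (q + boxVec (n + 1) (ιC t (s', r))) μ) = _
      rw [hpt]
    have h3 : ‖conjR (hol V q (Pout ++ Pin)) (X w μ) - F (ιC t (s', r))‖ ≤ 2 * (((3 * d + 1) * n : ℝ) ^ 2 * a) * ‖X w μ‖ := by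
      rw [hF']
      have hdisp : disp (Pout ++ Pin) = disp (treeWord (boxVec (n + 1) (ιC t (s', r)))) := by
        rw [disp_treeWord, hwC t ht (s', r), hPout, hPin, disp_append, disp_append, disp_treeWord, disp_treeWord, disp_seg]
        dsimp only
        abel
      have hrb := norm_conjR_hol_sub_conjR_hol_le V hV ha hplaq q (Pout ++ Pin) (treeWord (boxVec (n + 1) (ιC t (s', r)))) hdisp (X w μ)
      refine hrb.trans (mul_le_mul_of_nonneg_right ?_ (norm_nonneg _))
      have hℓ : (((Pout ++ Pin).length + (treeWord (boxVec (n + 1) (ιC t (s', r)))).length : ℕ) : ℝ) ≤ (3 * d + 1) * n := by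
        have e1 : ((Pout.length : ℕ) : ℝ) ≤ d * (L * L) := by rw [hPout]; exact length_treeWord_smul_boxVec_le L s'
        have e2 : ((Pin.length : ℕ) : ℝ) ≤ d * L + L := by
          have hr : ((l1 (boxVec L r) : ℕ) : ℝ) ≤ d * L := by exact_mod_cast l1_boxVec_le L r
          have ht' : (((t : ℤ).natAbs : ℕ) : ℝ) ≤ L := by rw [Int.natAbs_natCast]; exact_mod_cast ht.le
          rw [hPin, List.length_append, length_treeWord, length_seg]; push_cast; linarith
        have e3 := length_treeWord_boxVec_le (ιC t (s', r))
        have hLLr : (L : ℝ) * L ≤ n := by exact_mod_cast hLL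
        have hLr' : (L : ℝ) ≤ n := by exact_mod_cast hLn'
        have hd0 : (0 : ℝ) ≤ d := Nat.cast_nonneg _
        rw [List.length_append]; push_cast
        nlinarith only [e1, e2, e3, hLLr, hLr', hd0]
      have hB0 : (0 : ℝ) ≤ (3 * d + 1) * n := by positivity
      calc 2 * ((((Pout ++ Pin).length + (treeWord (boxVec (n + 1) (ιC t (s', r)))).length : ℕ) : ℝ)
              * ((((Pout ++ Pin).length + (treeWord (boxVec (n + 1) (ιC t (s', r)))).length : ℕ) : ℝ) * a))
            ≤ 2 * (((3 * d + 1) * n : ℝ) * (((3 * d + 1) * n : ℝ) * a)) := by gcongr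
        _ = 2 * (((3 * d + 1) * n : ℝ) ^ 2 * a) := by ring
    -- combine
    calc _ ≤ ‖conjR (hol V' q'' (treeWord (boxVec L s'))) Yv - conjR (hol V q Pout) Yv‖ + ‖conjR (hol V q Pout) Yv - F (ιC t (s', r))‖ :=
          norm_sub_le_norm_sub_add_norm_sub _ _ _
      _ ≤ 2 * (d * L * δ) * ‖X w μ‖ + 2 * (((3 * d + 1) * n : ℝ) ^ 2 * a) * ‖X w μ‖ := add_le_add h1 (by rw [h2]; exact h3)
      _ = κ₀ * ‖X w μ‖ := by rw [hκ₀]; ring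
  -- expansion of the next-level transported mean: `Σ_t c₂ • Σ_p Z t p + L⁻ᵈ • ED`
  set c2 : ℝ := ((((L * L : ℕ) : ℝ)) ^ d)⁻¹ with hc2
  have hc2' : (((L : ℝ) ^ d)⁻¹) * (((L : ℝ) ^ d)⁻¹) = c2 := by rw [hc2]; push_cast; rw [mul_pow, mul_inv]
  have hc2_0 : 0 ≤ c2 := by rw [hc2]; positivity
  have hc2le : c2 ≤ ((L : ℝ) ^ d)⁻¹ := by
    rw [hc2]; refine inv_anti₀ (by positivity) ?_
    push_cast; rw [mul_pow]; exact le_mul_of_one_le_left (by positivity) (one_le_pow₀ (by exact_mod_cast hL))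
  set Z : ℕ → (Fin d → Fin L) × (Fin d → Fin L) → Matrix (Fin N) (Fin N) ℂ := fun t p =>
    conjR (hol V' q'' (treeWord (boxVec L p.1)))
      (conjR (hol V (q + (L : ℤ) • boxVec L p.1) (treeWord (boxVec L p.2) ++ seg μ (t : ℤ)))
        (X (q + (L : ℤ) • boxVec L p.1 + boxVec L p.2 + (t : ℤ) • e μ) μ)) with hZ
  have hZapp : ∀ (t : ℕ) (s' r : Fin d → Fin L), Z t (s', r)
      = conjR (hol V' q'' (treeWord (boxVec L s')))
          (conjR (hol V (q + (L : ℤ) • boxVec L s') (treeWord (boxVec L r) ++ seg μ (t : ℤ)))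
            (X (q + (L : ℤ) • boxVec L s' + boxVec L r + (t : ℤ) • e μ) μ)) := fun _ _ _ => rfl
  set ED : Matrix (Fin N) (Fin N) ℂ := ∑ s' : Fin d → Fin L, conjR (hol V' q'' (treeWord (boxVec L s'))) (D (q'' + boxVec L s') μ) with hED
  have hexp : (((L : ℝ) ^ d)⁻¹) • ∑ s' : Fin d → Fin L, conjR (hol V' q'' (treeWord (boxVec L s'))) (X' (q'' + boxVec L s') μ)
      = ∑ t ∈ Finset.range L, c2 • ∑ p : (Fin d → Fin L) × (Fin d → Fin L), Z t p + (((L : ℝ) ^ d)⁻¹) • ED := by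
    have hs : ∀ s' : Fin d → Fin L, conjR (hol V' q'' (treeWord (boxVec L s'))) (X' (q'' + boxVec L s') μ)
        = ∑ r : Fin d → Fin L, ∑ t ∈ Finset.range L, (((L : ℝ) ^ d)⁻¹) • Z t (s', r)
          + conjR (hol V' q'' (treeWord (boxVec L s'))) (D (q'' + boxVec L s') μ) := by
      intro s'
      have hqs : (L : ℤ) • (q'' + boxVec L s') = q + (L : ℤ) • boxVec L s' := by rw [hq, smul_add]
      rw [hX' s', conjR_add, conjR_sum]
      refine congrArg₂ (· + ·) (Finset.sum_congr rfl fun r _ => ?_) rfl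
      rw [conjR_sum]
      refine Finset.sum_congr rfl fun t _ => ?_
      rw [conjR_smul_real, hqs, hZapp]
    have hs' : ∑ s' : Fin d → Fin L, conjR (hol V' q'' (treeWord (boxVec L s'))) (X' (q'' + boxVec L s') μ)
        = ∑ s' : Fin d → Fin L, (∑ r : Fin d → Fin L, ∑ t ∈ Finset.range L, (((L : ℝ) ^ d)⁻¹) • Z t (s', r)
          + conjR (hol V' q'' (treeWord (boxVec L s'))) (D (q'' + boxVec L s') μ)) := Finset.sum_congr rfl fun s' _ => hs s'
    rw [hs', Finset.sum_add_distrib, smul_add]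
    refine congrArg₂ (· + ·) ?_ rfl
    rw [Finset.smul_sum]
    calc ∑ s' : Fin d → Fin L, (((L : ℝ) ^ d)⁻¹) • ∑ r : Fin d → Fin L, ∑ t ∈ Finset.range L, (((L : ℝ) ^ d)⁻¹) • Z t (s', r)
        = ∑ s' : Fin d → Fin L, ∑ r : Fin d → Fin L, ∑ t ∈ Finset.range L, c2 • Z t (s', r) := by
          refine Finset.sum_congr rfl fun s' _ => ?_
          rw [Finset.smul_sum]; refine Finset.sum_congr rfl fun r _ => ?_
          rw [Finset.smul_sum]; refine Finset.sum_congr rfl fun t _ => ?_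
          rw [smul_smul, hc2']
      _ = ∑ s' : Fin d → Fin L, ∑ t ∈ Finset.range L, ∑ r : Fin d → Fin L, c2 • Z t (s', r) :=
          Finset.sum_congr rfl fun s' _ => Finset.sum_comm
      _ = ∑ t ∈ Finset.range L, ∑ s' : Fin d → Fin L, ∑ r : Fin d → Fin L, c2 • Z t (s', r) := Finset.sum_comm
      _ = ∑ t ∈ Finset.range L, c2 • ∑ p : (Fin d → Fin L) × (Fin d → Fin L), Z t p := by
          refine Finset.sum_congr rfl fun t _ => ?_
          rw [Finset.smul_sum, Fintype.sum_prod_type]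
  -- the decomposition `LHS = (L⁻¹Σ_t (MC t − F̄) − (mB − F̄)) + L⁻¹Σ_t EE t + (L⁻¹L⁻ᵈ) • ED`
  set mB : Matrix (Fin N) (Fin N) ℂ := (((L : ℝ) ^ d)⁻¹) • ∑ s : Fin d → Fin L, conjR (hol V q (treeWord (boxVec L s))) (X (q + boxVec L s) μ) with hmB
  set MC : ℕ → Matrix (Fin N) (Fin N) ℂ := fun t => c2 • ∑ p : (Fin d → Fin L) × (Fin d → Fin L), F (ιC t p) with hMC
  set EE : ℕ → Matrix (Fin N) (Fin N) ℂ := fun t => c2 • ∑ p : (Fin d → Fin L) × (Fin d → Fin L), (Z t p - F (ιC t p)) with hEE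
  have hsplit : ∀ t, c2 • ∑ p : (Fin d → Fin L) × (Fin d → Fin L), Z t p = MC t + EE t := by
    intro t; simp only [hMC, hEE, ← smul_add, ← Finset.sum_add_distrib, add_sub_cancel]
  have hconst : (L : ℝ)⁻¹ • ∑ t ∈ Finset.range L, (MC t - Fbar) = (L : ℝ)⁻¹ • ∑ t ∈ Finset.range L, MC t - Fbar := by
    rw [Finset.sum_sub_distrib, Finset.sum_const, Finset.card_range, ← Nat.cast_smul_eq_nsmul ℝ, smul_sub, smul_smul,
      inv_mul_cancel₀ hLr.ne', one_smul]
  have hdecomp : (L : ℝ)⁻¹ • ((((L : ℝ) ^ d)⁻¹) • ∑ s' : Fin d → Fin L, conjR (hol V' q'' (treeWord (boxVec L s'))) (X' (q'' + boxVec L s') μ)) - mB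
      = ((L : ℝ)⁻¹ • ∑ t ∈ Finset.range L, (MC t - Fbar) - (mB - Fbar))
        + ((L : ℝ)⁻¹ • ∑ t ∈ Finset.range L, EE t + ((L : ℝ)⁻¹ * (((L : ℝ) ^ d)⁻¹)) • ED) := by
    rw [hexp, Finset.sum_congr rfl (fun t _ => hsplit t), Finset.sum_add_distrib, hconst]
    generalize ∑ t ∈ Finset.range L, MC t = S1
    generalize ∑ t ∈ Finset.range L, EE t = S2
    rw [smul_add, smul_add, mul_smul]
    abel
  have hcardB : (Fintype.card (Fin d → Fin L) : ℝ) = (L : ℝ) ^ d := by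
    rw [Fintype.card_fun, Fintype.card_fin, Fintype.card_fin]; push_cast; ring
  have hcardC : (Fintype.card ((Fin d → Fin L) × (Fin d → Fin L)) : ℝ) = (((L * L : ℕ) : ℝ)) ^ d := by
    rw [Fintype.card_prod, Fintype.card_fun, Fintype.card_fin, Fintype.card_fin]; push_cast; ring
  have hB : ‖mB - Fbar‖ ^ 2 ≤ ((L : ℝ) ^ d)⁻¹ * P := by
    have hJ := normSq_mean_comp_sub_le ιB hιB F Fbar
    rw [hcardB] at hJ
    have hre : ∑ s, F (ιB s) = ∑ s : Fin d → Fin L, conjR (hol V q (treeWord (boxVec L s))) (X (q + boxVec L s) μ) := by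
      refine Finset.sum_congr rfl fun s _ => ?_
      show conjR (hol V q (treeWord (boxVec (n + 1) (ιB s)))) (X (q + boxVec (n + 1) (ιB s)) μ) = _
      rw [hwB s]
    rw [hre] at hJ; exact hJ
  have hC : ∀ t, ‖MC t - Fbar‖ ^ 2 ≤ ((L : ℝ) ^ d)⁻¹ * P := by
    intro t
    have hJ := normSq_mean_comp_sub_le (ιC t) (hιC t) F Fbar
    rw [hcardC] at hJ
    exact hJ.trans (mul_le_mul_of_nonneg_right hc2le hP0)
  have hsqrt : ∀ (v : Matrix (Fin N) (Fin N) ℂ) (x : ℝ), ‖v‖ ^ 2 ≤ x → ‖v‖ ≤ Real.sqrt x := fun v x hv => by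
    rw [← Real.sqrt_sq (norm_nonneg v)]; exact Real.sqrt_le_sqrt hv
  set R : ℝ := Real.sqrt (((L : ℝ) ^ d)⁻¹ * P) with hR
  have hR0 : 0 ≤ R := Real.sqrt_nonneg _
  have hLd0 : (0 : ℝ) ≤ ((L : ℝ) ^ d)⁻¹ := by positivity
  have hRsq : R ^ 2 = ((L : ℝ) ^ d)⁻¹ * P := Real.sq_sqrt (mul_nonneg hLd0 hP0)
  -- the main (Poincaré) part
  have hM : ‖(L : ℝ)⁻¹ • ∑ t ∈ Finset.range L, (MC t - Fbar) - (mB - Fbar)‖ ≤ 2 * R := by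
    have hCn : ∀ t ∈ Finset.range L, ‖MC t - Fbar‖ ≤ R := fun t _ => hsqrt _ _ (hC t)
    have hsumn : ‖(L : ℝ)⁻¹ • ∑ t ∈ Finset.range L, (MC t - Fbar)‖ ≤ R := by
      rw [norm_smul, Real.norm_eq_abs, abs_of_pos (inv_pos.2 hLr)]
      calc (L : ℝ)⁻¹ * ‖∑ t ∈ Finset.range L, (MC t - Fbar)‖ ≤ (L : ℝ)⁻¹ * ∑ t ∈ Finset.range L, ‖MC t - Fbar‖ :=
            mul_le_mul_of_nonneg_left (norm_sum_le _ _) (inv_pos.2 hLr).le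
        _ ≤ (L : ℝ)⁻¹ * ∑ t ∈ Finset.range L, R := mul_le_mul_of_nonneg_left (Finset.sum_le_sum hCn) (inv_pos.2 hLr).le
        _ = R := by rw [Finset.sum_const, Finset.card_range, nsmul_eq_mul]; field_simp
    calc _ ≤ ‖(L : ℝ)⁻¹ • ∑ t ∈ Finset.range L, (MC t - Fbar)‖ + ‖mB - Fbar‖ := norm_sub_le _ _
      _ ≤ R + R := add_le_add hsumn (hsqrt _ _ hB)
      _ = 2 * R := by ring
  -- the transport error part
  have hEt : ∀ t, t < L → ‖EE t‖ ≤ κ₀ * Real.sqrt (((L : ℝ) ^ d)⁻¹ * MASS) := by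
    intro t ht
    have hsum : ‖∑ p : (Fin d → Fin L) × (Fin d → Fin L), (Z t p - F (ιC t p))‖
        ≤ κ₀ * ∑ p : (Fin d → Fin L) × (Fin d → Fin L), ‖X (q + boxVec (n + 1) (ιC t p)) μ‖ := by
      rw [Finset.mul_sum]
      refine (norm_sum_le _ _).trans (Finset.sum_le_sum fun p _ => ?_)
      obtain ⟨s', r⟩ := p
      have hpt : q + (L : ℤ) • boxVec L s' + boxVec L r + (t : ℤ) • e μ = q + boxVec (n + 1) (ιC t (s', r)) := by
        rw [hwC t ht (s', r)]; dsimp only; abel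
      calc ‖Z t (s', r) - F (ιC t (s', r))‖ ≤ κ₀ * ‖X (q + (L : ℤ) • boxVec L s' + boxVec L r + (t : ℤ) • e μ) μ‖ := by
            rw [hZapp]; exact hterm t ht s' r
        _ = κ₀ * ‖X (q + boxVec (n + 1) (ιC t (s', r))) μ‖ := by rw [hpt]
    have h2 : ∑ p : (Fin d → Fin L) × (Fin d → Fin L), ‖X (q + boxVec (n + 1) (ιC t p)) μ‖ ^ 2 ≤ MASS := by
      have hinj : ∑ p : (Fin d → Fin L) × (Fin d → Fin L), ‖X (q + boxVec (n + 1) (ιC t p)) μ‖ ^ 2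
          ≤ ∑ ρ : Fin d → Fin (n + 1), ‖X (q + boxVec (n + 1) ρ) μ‖ ^ 2 := by
        rw [← Finset.sum_image (f := fun ρ : Fin d → Fin (n + 1) => ‖X (q + boxVec (n + 1) ρ) μ‖ ^ 2) (s := Finset.univ) (g := ιC t)
          (fun a _ b _ hab => hιC t hab)]
        exact Finset.sum_le_sum_of_subset_of_nonneg (Finset.subset_univ _) fun _ _ _ => sq_nonneg _
      refine hinj.trans ?_
      rw [hMASS]
      exact Finset.single_le_sum (s := (Finset.univ : Finset (Fin d)))
        (f := fun μ' : Fin d => ∑ ρ : Fin d → Fin (n + 1), ‖X (q + boxVec (n + 1) ρ) μ'‖ ^ 2)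
        (fun _ _ => Finset.sum_nonneg fun _ _ => sq_nonneg _) (Finset.mem_univ μ)
    have hCS : ∑ p : (Fin d → Fin L) × (Fin d → Fin L), ‖X (q + boxVec (n + 1) (ιC t p)) μ‖
        ≤ Real.sqrt ((((L * L : ℕ) : ℝ)) ^ d * MASS) := by
      have h1 := sq_sum_le_card_mul_sum_sq (s := (Finset.univ : Finset ((Fin d → Fin L) × (Fin d → Fin L))))
        (f := fun p => ‖X (q + boxVec (n + 1) (ιC t p)) μ‖)
      rw [Finset.card_univ, hcardC] at h1
      exact (le_abs_self _).trans (Real.abs_le_sqrt (h1.trans (mul_le_mul_of_nonneg_left h2 (by positivity))))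
    have hsc : c2 * Real.sqrt ((((L * L : ℕ) : ℝ)) ^ d * MASS) = Real.sqrt (c2 * MASS) := by
      have hpos : (0 : ℝ) < (((L * L : ℕ) : ℝ)) ^ d := by positivity
      have h : c2 * MASS = c2 ^ 2 * ((((L * L : ℕ) : ℝ)) ^ d * MASS) := by rw [hc2]; field_simp
      rw [h, Real.sqrt_mul (sq_nonneg _), Real.sqrt_sq hc2_0]
    calc ‖EE t‖ = c2 * ‖∑ p : (Fin d → Fin L) × (Fin d → Fin L), (Z t p - F (ιC t p))‖ := by
          rw [hEE]; exact (norm_smul _ _).trans (by rw [Real.norm_of_nonneg hc2_0])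
      _ ≤ c2 * (κ₀ * Real.sqrt ((((L * L : ℕ) : ℝ)) ^ d * MASS)) :=
          mul_le_mul_of_nonneg_left (hsum.trans (mul_le_mul_of_nonneg_left hCS hκ₀0)) hc2_0
      _ = κ₀ * Real.sqrt (c2 * MASS) := by rw [← hsc]; ring
      _ ≤ κ₀ * Real.sqrt (((L : ℝ) ^ d)⁻¹ * MASS) :=
          mul_le_mul_of_nonneg_left (Real.sqrt_le_sqrt (mul_le_mul_of_nonneg_right hc2le hMASS0)) hκ₀0
  have hE : ‖(L : ℝ)⁻¹ • ∑ t ∈ Finset.range L, EE t‖ ≤ κ₀ * Real.sqrt (((L : ℝ) ^ d)⁻¹ * MASS) := by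
    rw [norm_smul, Real.norm_eq_abs, abs_of_pos (inv_pos.2 hLr)]
    calc (L : ℝ)⁻¹ * ‖∑ t ∈ Finset.range L, EE t‖ ≤ (L : ℝ)⁻¹ * ∑ t ∈ Finset.range L, ‖EE t‖ :=
          mul_le_mul_of_nonneg_left (norm_sum_le _ _) (inv_pos.2 hLr).le
      _ ≤ (L : ℝ)⁻¹ * ∑ t ∈ Finset.range L, κ₀ * Real.sqrt (((L : ℝ) ^ d)⁻¹ * MASS) :=
          mul_le_mul_of_nonneg_left (Finset.sum_le_sum fun t ht => hEt t (Finset.mem_range.mp ht)) (inv_pos.2 hLr).le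
      _ = κ₀ * Real.sqrt (((L : ℝ) ^ d)⁻¹ * MASS) := by rw [Finset.sum_const, Finset.card_range, nsmul_eq_mul]; field_simp
  -- the defect part
  have hDn : ‖((L : ℝ)⁻¹ * (((L : ℝ) ^ d)⁻¹)) • ED‖ ≤ (L : ℝ)⁻¹ * Real.sqrt (((L : ℝ) ^ d)⁻¹ * DD) := by
    have h1 : ‖ED‖ ≤ ∑ s' : Fin d → Fin L, ‖D (q'' + boxVec L s') μ‖ := by
      rw [hED]; refine (norm_sum_le _ _).trans (Finset.sum_le_sum fun s' _ => ?_)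
      exact (norm_conjR (hol_mem hV' _ _) _).le
    have h2 : (∑ s' : Fin d → Fin L, ‖D (q'' + boxVec L s') μ‖) ^ 2 ≤ ((L : ℝ) ^ d) * DD := by
      have := sq_sum_le_card_mul_sum_sq (s := (Finset.univ : Finset (Fin d → Fin L))) (f := fun s' => ‖D (q'' + boxVec L s') μ‖)
      rw [Finset.card_univ, hcardB] at this
      exact this
    have h3 : ‖ED‖ ≤ Real.sqrt (((L : ℝ) ^ d) * DD) :=
      (le_abs_self _).trans (Real.abs_le_sqrt ((pow_le_pow_left₀ (norm_nonneg _) h1 2).trans h2))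
    have hsc : (((L : ℝ) ^ d)⁻¹) * Real.sqrt (((L : ℝ) ^ d) * DD) = Real.sqrt (((L : ℝ) ^ d)⁻¹ * DD) := by
      have hpos : (0 : ℝ) < (L : ℝ) ^ d := by positivity
      have h : ((L : ℝ) ^ d)⁻¹ * DD = (((L : ℝ) ^ d)⁻¹) ^ 2 * (((L : ℝ) ^ d) * DD) := by field_simp
      rw [h, Real.sqrt_mul (sq_nonneg _), Real.sqrt_sq hLd0]
    rw [norm_smul, Real.norm_of_nonneg (mul_nonneg (inv_pos.2 hLr).le hLd0), mul_assoc, ← hsc]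
    exact mul_le_mul_of_nonneg_left (mul_le_mul_of_nonneg_left h3 hLd0) (inv_pos.2 hLr).le
  have add_add_sq_le_three : ∀ x y t : ℝ, (x + y + t) ^ 2 ≤ 3 * (x ^ 2 + y ^ 2 + t ^ 2) := fun x y t => by
    nlinarith only [sq_nonneg (x - y), sq_nonneg (y - t), sq_nonneg (x - t)]
  have htot : ‖(L : ℝ)⁻¹ • ((((L : ℝ) ^ d)⁻¹) • ∑ s' : Fin d → Fin L, conjR (hol V' q'' (treeWord (boxVec L s'))) (X' (q'' + boxVec L s') μ)) - mB‖
      ≤ 2 * R + κ₀ * Real.sqrt (((L : ℝ) ^ d)⁻¹ * MASS) + (L : ℝ)⁻¹ * Real.sqrt (((L : ℝ) ^ d)⁻¹ * DD) := by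
    rw [hdecomp]
    calc _ ≤ ‖(L : ℝ)⁻¹ • ∑ t ∈ Finset.range L, (MC t - Fbar) - (mB - Fbar)‖
            + ‖(L : ℝ)⁻¹ • ∑ t ∈ Finset.range L, EE t + ((L : ℝ)⁻¹ * (((L : ℝ) ^ d)⁻¹)) • ED‖ := norm_add_le _ _
      _ ≤ 2 * R + (κ₀ * Real.sqrt (((L : ℝ) ^ d)⁻¹ * MASS) + (L : ℝ)⁻¹ * Real.sqrt (((L : ℝ) ^ d)⁻¹ * DD)) :=
          add_le_add hM ((norm_add_le _ _).trans (add_le_add hE hDn))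
      _ = _ := by ring
  have hsq3 : ‖(L : ℝ)⁻¹ • ((((L : ℝ) ^ d)⁻¹) • ∑ s' : Fin d → Fin L, conjR (hol V' q'' (treeWord (boxVec L s'))) (X' (q'' + boxVec L s') μ)) - mB‖ ^ 2
      ≤ 3 * (4 * (((L : ℝ) ^ d)⁻¹ * P) + κ₀ ^ 2 * (((L : ℝ) ^ d)⁻¹ * MASS) + ((L : ℝ) ^ 2)⁻¹ * (((L : ℝ) ^ d)⁻¹ * DD)) := by
    have hm0 : 0 ≤ ((L : ℝ) ^ d)⁻¹ * MASS := mul_nonneg hLd0 hMASS0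
    have hd0 : 0 ≤ ((L : ℝ) ^ d)⁻¹ * DD := mul_nonneg hLd0 hDD0
    calc _ ≤ (2 * R + κ₀ * Real.sqrt (((L : ℝ) ^ d)⁻¹ * MASS) + (L : ℝ)⁻¹ * Real.sqrt (((L : ℝ) ^ d)⁻¹ * DD)) ^ 2 :=
          pow_le_pow_left₀ (norm_nonneg _) htot 2
      _ ≤ 3 * ((2 * R) ^ 2 + (κ₀ * Real.sqrt (((L : ℝ) ^ d)⁻¹ * MASS)) ^ 2 + ((L : ℝ)⁻¹ * Real.sqrt (((L : ℝ) ^ d)⁻¹ * DD)) ^ 2) :=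
          add_add_sq_le_three _ _ _
      _ = _ := by rw [mul_pow, hRsq, mul_pow, Real.sq_sqrt hm0, mul_pow, Real.sq_sqrt hd0, inv_pow]; ring
  refine hsq3.trans ?_
  have key := mul_le_mul_of_nonneg_left hPle hLd0
  linarith only [key]

end Row

end Summit.QuantumFields.YangMills.Theorems.Prop7CornerCombDressedStepMean
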